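import Summits.AtomisticToContinuum.HydrodynamicLimit.Theorems.JParityClosureParityBandClosureDetailedBalanceOfSymmetricRecord
import Summits.AtomisticToContinuum.HydrodynamicLimit.Theorems.JParityClosureRateFloorGainSpreading
import HarnessLib

/-!
# `J`-invariance of a collision record from the vanishing of its `J`-odd integrals
(stub `stub_mapInverseCollisionOfOddIntegrals`)

Helper for the line `Sketch` of the crux `JParityClosure.ParityBandClosure`
(stmt-AtomisticToContinuum-17608), sub-goal of the skeleton stub `stub_maxwellDefectVanishes`.

WHAT. Let `ν` be a finite Borel measure on the collision-record space `Q = (V3 × V3) × S²`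
(pre-collisional pair and impact direction) and `J q = (collide q.2 q.1, −q.2)` the
inverse-collision map. ASSUME every bounded continuous `J`-odd real function integrates to zero
against `ν`. THEN `ν` is `J`-invariant: `ν.map J = ν`.

PROOF. (1) `J` is a continuous involution: the collision law only sees the line of the impact
direction, `collide (−ω) p = collide ω p` (`RateFloorGainSpreading.collide_neg_dir`), and
`collide ω` is an involution (`collide_collide`), so `J (J q) = q`
(`inverseCollision_inverseCollision`). (2) For a bounded continuous `f : Q →ᵇ ℝ` the function
`Ψ = f − f ∘ J` is continuous, bounded by `2‖f‖` (`BoundedContinuousFunction.dist_le_two_norm`)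
and `J`-odd by (1); the hypothesis gives `∫ f dν = ∫ f ∘ J dν = ∫ f d(ν.map J)`
(`integral_map`). (3) Two finite Borel measures on the metric space `Q` with the same integrals
of all bounded continuous real functions coincide (`ext_of_forall_integral_eq_of_IsFiniteMeasure`;
`Q` is metrizable, hence `HasOuterApproxClosed`, and second countable, hence `BorelSpace` for the
product σ-algebra).

REFERENCES. C. Cercignani, R. Illner, M. Pulvirenti, *The Mathematical Theory of Dilute Gases*,
1994, §3.1 (micro-reversibility `(v, w, n̂) ↦ (v′, w′, −n̂)` is an involution); the
measure-theoretic step is the Riesz/Portmanteau uniqueness of finite Borel measures on metric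
spaces (Mathlib `MeasureTheory.ext_of_forall_integral_eq_of_IsFiniteMeasure`).
-/

noncomputable section

namespace Summit.AtomisticToContinuum.HydrodynamicLimit.Theorems.ParityBandClosureDetailedBalance

open scoped BigOperators ENNReal
open MeasureTheory
open Literature.MathematicalPhysics.KineticTheory Literature.Analysis.FluidPDE

/-- The inverse-collision map `J (p, ω) = (collide ω p, −ω)` on `(V3 × V3) × S²` is an involution:
`J (J q) = q` (the collision law does not see the orientation of `ω`, and `collide ω` is an
involution). [folklore] -/
theorem inverseCollision_inverseCollision (q : (V3 × V3) × Metric.sphere (0 : V3) 1) :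
    (fun q : (V3 × V3) × Metric.sphere (0 : V3) 1 => (collide q.2 q.1, -q.2))
      ((fun q : (V3 × V3) × Metric.sphere (0 : V3) 1 => (collide q.2 q.1, -q.2)) q) = q := by
  obtain ⟨p, ω⟩ := q
  simp only [RateFloorGainSpreading.collide_neg_dir, collide_collide, neg_neg]

/-- **STUB `stub_mapInverseCollisionOfOddIntegrals` (line `Sketch`, crux `ParityBandClosure`,
stmt-17608): `J`-invariance of a finite collision record from the vanishing of its `J`-odd
integrals.** For a finite measure `ν` on `(V3 × V3) × S²` and the inverse collision
`J q = (collide q.2 q.1, −q.2)`: if `∫ Ψ dν = 0` for every continuous bounded `Ψ` with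
`Ψ ∘ J = −Ψ`, then `ν.map J = ν` (test `Ψ = f − f ∘ J` for bounded continuous `f`, `integral_map`,
and uniqueness of finite Borel measures on a metric space from their integrals of bounded
continuous functions). [folklore] -/
theorem stub_mapInverseCollisionOfOddIntegrals : ∀ (ν : Measure ((V3 × V3) × Metric.sphere (0 : V3) 1)), IsFiniteMeasure ν → (let J : (V3 × V3) × Metric.sphere (0 : V3) 1 → (V3 × V3) × Metric.sphere (0 : V3) 1 := fun q => (collide q.2 q.1, -q.2); (∀ Ψ : (V3 × V3) × Metric.sphere (0 : V3) 1 → ℝ, Continuous Ψ → (∃ C : ℝ, ∀ q, |Ψ q| ≤ C) → (∀ q, Ψ (J q) = -Ψ q) → ∫ q, Ψ q ∂ν = 0) → ν.map J = ν) := by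
  intro ν hν J hodd
  have hJc : Continuous J := continuous_inverseCollision
  have hJm : Measurable J := measurable_inverseCollision
  have hJJ : ∀ q, J (J q) = q := inverseCollision_inverseCollision
  refine ext_of_forall_integral_eq_of_IsFiniteMeasure fun f => ?_
  rw [integral_map hJm.aemeasurable f.continuous.aestronglyMeasurable]
  -- `Ψ = f − f ∘ J` is bounded, continuous and `J`-odd
  have hfJ : Integrable (fun q => f (J q)) ν :=
    (f.integrable (ν.map J)).comp_measurable hJm
  have h0 : ∫ q, (f q - f (J q)) ∂ν = 0 := by
    refine hodd (fun q => f q - f (J q)) (f.continuous.sub (f.continuous.comp hJc))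
      ⟨2 * ‖f‖, fun q => ?_⟩ (fun q => ?_)
    · rw [← Real.dist_eq]
      exact f.dist_le_two_norm q (J q)
    · simp only [hJJ, neg_sub]
  rw [integral_sub (f.integrable ν) hfJ, sub_eq_zero] at h0
  exact h0.symm

end Summit.AtomisticToContinuum.HydrodynamicLimit.Theorems.ParityBandClosureDetailedBalance

end
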